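import Summits.AtomisticToContinuum.HydrodynamicLimit.Theses.AntiMazurCoboundaries
import HarnessLib

/-!
# Objects of the crux line `meso-window-split` (crux `KineticFluxLdDecay`, stmt-AtomisticToContinuum-10967;
# routes AntiMazurCoboundaries r4 / FluxGibbsianityLdDrude r2)

Objects module of the registered skeleton `Cruxes/KineticFluxLdDecay/Lines/meso_window_split.lean` (lead c3):
the frame abbreviations of the line (`Flow`, `ClusterFlows`, `Phase`, `gibbs`, `scale`, `horizon`, `Orthogonal`,
`fluxObs`, `ldLHS`, `badCount`) and the STATEMENTS of its four registered stubs (`WindowMonotone`,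
`MesoDecay`, `LightConeMeso`, `LocalityTransfer`, with the consequent `MesoLocality`), moved verbatim into ONE
importable `Theorems` module so that the stub helper files of the line (one per registered stub, landed
`--supports stmt-AtomisticToContinuum-10967`) and the skeleton share a single copy of every definition (same
device as `…KineticFluxLdDecaySelfTiltObjects` for the sibling line). Definitions only: the basic API of the
frame (`measurable_fluxObs`, `abs_fluxObs_le`) is already landed for the reducibly-equal frame of
`…Theorems.CorrectorPressureDecay.Negative.FastSectorSandwichFrame` and is not restated.

The line (card `Cruxes/KineticFluxLdDecay/Lines/meso-window-split.md`): the crux asks decay in the kinetic horizon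
`τ` AND uniformity in `N`; window monotonicity (`WindowMonotone`, Hölder over sub-windows + invariance, TRUE)
propagates a bound from one horizon to every longer one, so decay may be certified on SOME mesoscopic horizon
(`MesoDecay`, the dynamical bet, implied by the crux and strictly weaker), while uniformity becomes locality of the
window pressure across system sizes (`MesoLocality`), to be derived from an LD light cone (`LightConeMeso`) by
statics (`LocalityTransfer`). STATUS at landing (lead c3, 2026-08-16): `WindowMonotone` provable now;
`MesoDecay` crux-sized (its horizon cap is load-bearing); `LightConeMeso` is, by the steered-dispersal-cascade
analysis of the sibling crux InfluenceLocality (stmt-13916, `Cruxes/InfluenceLocality/SteeredDispersalCascades.md`),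
heuristically FALSE for every exponent (exponential moments of the bad-forecast COUNT fail above a threshold
`lam**(T) → 0` as the horizon `T → ∞`, which the mesoscopic horizon forces) — it is recorded here as a typed
`Prop` precisely so that a `¬ LightConeMeso` theorem has a home; nothing in this module asserts any stub.
-/

noncomputable section

open MeasureTheory Set Filter
open scoped ENNReal Classical

namespace Summit.AtomisticToContinuum.HydrodynamicLimit.Theorems.MesoWindowSplit

open Literature.MathematicalPhysics.KineticTheory (T3 V3 hsDiameter localGibbsLaw)
open Literature.Analysis.FluidPDE (HardSphereFlow Config localClusterState)

/-! ## Frame (reducible abbreviations; the crux decl is matched by unfolding) -/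

/-- Hard-sphere flows of `N + 1` spheres of diameter `σ ℓ_N` on `𝕋³` (the crux's `Φ`). -/
abbrev Flow (σ : ℝ) (N : ℕ) : Type :=
  HardSphereFlow (Literature.Analysis.FluidPDE.Torus.geometry (Fin 3)) (hsDiameter σ N) (N + 1)

/-- Families of isolated cluster flows (same diameter, every particle number), as in InfluenceLocality. -/
abbrev ClusterFlows (σ : ℝ) (N : ℕ) : Type :=
  (k : ℕ) → HardSphereFlow (Literature.Analysis.FluidPDE.Torus.geometry (Fin 3)) (hsDiameter σ N) k

/-- Phase space of `N + 1` spheres on `𝕋³`. -/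
abbrev Phase (N : ℕ) : Type := Config (N + 1) (Fin 3) T3

/-- The flow-invariant global Gibbs law `G_N` of the crux (constant profiles `a, u₀, θ`). -/
abbrev gibbs (σ a θ : ℝ) (u₀ : V3) (N : ℕ) (Φ : Flow σ N) : Measure (Phase N) :=
  localGibbsLaw σ (fun _ => a) (fun _ => u₀) (fun _ => θ) N Φ

/-- The microscopic length `ℓ_N = (N+1)^{-1/3}` (spelled exactly as in the crux). -/
abbrev scale (N : ℕ) : ℝ := ((N + 1 : ℕ) : ℝ) ^ (-(1 / 3 : ℝ))

/-- The reference kinetic horizon `τ_M = (M+1)^γ` of the size `M`. -/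
abbrev horizon (γ : ℝ) (M : ℕ) : ℝ := ((M + 1 : ℕ) : ℝ) ^ γ

/-- The orthogonality clause of the crux: `g ⊥ span{1, v, |v|²}` in `L²(stdGaussian ℝ³)`. -/
abbrev Orthogonal (g : V3 → ℝ) : Prop :=
  ∀ (c₀ c₂ : ℝ) (b : V3),
    ∫ v, g v * (c₀ + inner ℝ b v + c₂ * ‖v‖ ^ 2) ∂(ProbabilityTheory.stdGaussian V3) = 0

/-- The fast one-body observable `F(z) = Σᵢ φ(xᵢ) g((vᵢ − u₀)/√θ)` of the crux. -/
abbrev fluxObs (θ : ℝ) (u₀ : V3) (φ : T3 → ℝ) (g : V3 → ℝ) (N : ℕ) (z : Phase N) : ℝ :=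
  ∑ i, φ (z i).1 * g ((Real.sqrt θ)⁻¹ • ((z i).2 - u₀))

/-- The LD functional `I_N(h; φ, g) = ∫ exp(h⁻¹ ∫₀ʰ F(Φ_s z) ds) dG_N` at window LENGTH `h`
(the crux's left-hand side is `ldLHS … (τ * scale N) N Φ`). -/
abbrev ldLHS (σ a θ : ℝ) (u₀ : V3) (φ : T3 → ℝ) (g : V3 → ℝ) (h : ℝ) (N : ℕ) (Φ : Flow σ N) :
    ℝ≥0∞ :=
  ∫⁻ z, ENNReal.ofReal (Real.exp (h⁻¹ * ∫ s in (0 : ℝ)..h, fluxObs θ u₀ φ g N (Φ.flow s z)))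
    ∂(gibbs σ a θ u₀ N Φ)

/-- `#bad(T, r)`: the number of particles whose true state differs from their range-`r` local forecast
(`localClusterState`, tree) at some time of the window `[0, T]` (`T`, `r` macroscopic lengths; verbatim the
`Finset.card` of InfluenceLocality stmt-13916, with horizon and range made explicit). -/
abbrev badCount {σ : ℝ} {N : ℕ} (Φ : Flow σ N) (Ψ : ClusterFlows σ N) (T r : ℝ) (z : Phase N) : ℕ :=
  (Finset.univ.filter fun i : Fin (N + 1) =>
      ∃ t ∈ Set.Icc (0 : ℝ) T, Φ.flow t z i ≠ localClusterState Ψ r t z i).card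

/-! ## Stub statements -/

/-- Statement of `stub_windowMonotone` — **window monotonicity in exponential currency** (the card's lever,
general form with remainder). For a hard-sphere flow `Φ` on `𝕋³`, a `Φ`-invariant probability law `μ`
carried by the good set, a measurable `F` with `|F| ≤ K`, and windows `0 < h ≤ w`: if
`∫ exp(h⁻¹∫₀ʰ F∘Φ_s) dμ ≤ e^A` with `A ≥ 0` then `∫ exp(w⁻¹∫₀ʷ F∘Φ_s) dμ ≤ e^{A + (h/w) K}`.
Proof plan (size M): `w = m h + r`, `m = ⌊w/h⌋ ≥ 1`, `0 ≤ r < h`; on good orbits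
`exp(w⁻¹∫₀ʷ) = Πₖ Xₖ^{h/w} · Y^{r/w}` with `Xₖ = exp(h⁻¹∫_{kh}^{(k+1)h} F∘Φ) = X₀ ∘ Φ_{kh}` (`flow_add`) and
`Y = exp(r⁻¹∫_{mh}^{w} F∘Φ) ≤ e^K` POINTWISE; generalised Hölder with exponents `h/w` (`m` times) on the
probability space (`Σ = mh/w ≤ 1`, `ENNReal.lintegral_prod_norm_pow_le` + Jensen for the deficit) and
invariance (`MeasurePreserving.lintegral_comp`) give `I(w) ≤ I(h)^{mh/w} e^{Kr/w} ≤ e^{A + Kh/w}`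
(`A, K ≥ 0`, `r < h`). Joint `(s, z)`-measurability on `ℝ × good`: `HardSphereFlow.measurable_piecewise_flow_torus`. -/
def WindowMonotone : Prop :=
  ∀ (ε : ℝ) (N : ℕ) (Φ : HardSphereFlow (Literature.Analysis.FluidPDE.Torus.geometry (Fin 3)) ε (N + 1))
    (μ : Measure (Phase N)), IsProbabilityMeasure μ → (∀ t, MeasurePreserving (Φ.flow t) μ μ) →
    (∀ᵐ z ∂μ, z ∈ Φ.good) →
    ∀ (F : Phase N → ℝ) (K : ℝ), Measurable F → (∀ z, |F z| ≤ K) →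
    ∀ (h w A : ℝ), 0 < h → h ≤ w → 0 ≤ A →
      ∫⁻ z, ENNReal.ofReal (Real.exp (h⁻¹ * ∫ s in (0 : ℝ)..h, F (Φ.flow s z))) ∂μ
          ≤ ENNReal.ofReal (Real.exp A) →
      ∫⁻ z, ENNReal.ofReal (Real.exp (w⁻¹ * ∫ s in (0 : ℝ)..w, F (Φ.flow s z))) ∂μ
          ≤ ENNReal.ofReal (Real.exp (A + h / w * K))

/-- Statement of `stub_mesoDecay` — **LD decay on SOME mesoscopic, sub-polynomial horizon** (the card's
`MesoFluxLd`, with the horizon freed: triage r1-1 "horizons growing with N have no known source at any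
prescribed rate"). Crux frame (`σ < σ₀`, `∃ κ` before `φ, g`, all four admissibility clauses of the crux kept —
each is load-bearing by the window-independent Gibbs-tilt witnesses of `Disproof.lean`), then: for every
exponent `γ > 0` and `δ > 0`, for all large `M` there is a kinetic horizon `0 < τ ≤ δ (M+1)^γ` with
`∫ exp(avg over [0, τ ℓ_M] of F∘Φ) dG_M ≤ e^{δ(M+1)}` for every flow. IMPLIED BY THE CRUX (take its `τ(δ)` and
`M` large) and strictly weaker: the horizon may depend on `M` (any `τ(M) = M^{o(1)}`), so relaxation times
diverging with `M` and restart schemes with accumulating errors are admissible here and lethal for the crux. -/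
def MesoDecay : Prop :=
  ∀ (a θ : ℝ) (u₀ : V3), 0 < a → 0 < θ → ∃ σ₀ : ℝ, 0 < σ₀ ∧ ∀ σ : ℝ, 0 < σ → σ < σ₀ →
    ∃ κ : ℝ, 0 < κ ∧ ∀ (φ : T3 → ℝ) (g : V3 → ℝ), Continuous φ → Continuous g →
      (∀ x, |φ x| ≤ 1) → (∀ v, |g v| ≤ κ) → Orthogonal g →
      ∀ γ : ℝ, 0 < γ → ∀ δ : ℝ, 0 < δ → ∃ N₁ : ℕ, ∀ M : ℕ, N₁ ≤ M →
        ∃ τ : ℝ, 0 < τ ∧ τ ≤ δ * horizon γ M ∧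
          ∀ Φ : Flow σ M,
            ldLHS σ a θ u₀ φ g (τ * scale M) M Φ ≤ ENNReal.ofReal (Real.exp (δ * (M + 1)))

/-- Statement of `stub_lightConeMeso` — **LD finite speed of influence at mesoscopic horizon and range**
(the exponential-moment form triage r1-1/2/3 showed the locality half needs; InfluenceLocality 13916 is its
fixed-horizon, `∃ R` version). For `σ < σ₀` there is `γ₀ > 0` such that for every `0 < γ ≤ γ₀`, `lam, δ > 0`,
for all large `M` and EVERY `N ≥ M`, every flow `Φ` and cluster family `Ψ` at size `N`:
`∫ exp(lam · #bad(T = (M+1)^γ ℓ_N, r = (M+1)^{1/4} ℓ_N)) dG_N ≤ e^{δ(N+1)}` — horizon `(M+1)^γ` kinetic units,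
forecast range `(M+1)^{1/4}` microscopic units `≪ (M+1)^{1/3}` = side of the reference torus, so the SAME
light cone serves the big system `N` and sub-cells of the reference system `M`. Why `γ₀` must be small
(planner's cost table, ℓ-units, density 1, `θ = 1`, `T = M^γ`, `R = M^{1/4}`): a carrier of speed `u` flies
`uT`; every sphere it deflects beyond distance `R` from its start seeds a collision cascade that saturates its
forward cone (`σ²T → ∞` mean free times), so `#bad ≈ (uT − R)·T²` at Maxwellian cost `u²/2`; optimum `u = 2R/T`,
cost per corrupted forecast `2R/T⁴ = 2M^{1/4 − 4γ}` → ∞ iff `γ < 1/16`; relay rows (13916 Disproof item 4) cost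
`≳ σ²R` per row for `≈ T³` bad (`γ < 1/12`); near-jammed blobs `3 log(R/σT)` per sphere; hot spots `R²/T²`.
Nothing with bounded cost per bad particle for `γ < 1/16`; the typical bad fraction is `e^{-2M^{2(1/4−γ)}}`-small.
STATUS (lead c3): the planner's table is SUPERSEDED by the steered dispersal cascades of the sibling crux 13916
(`Cruxes/InfluenceLocality/SteeredDispersalCascades.md`): redistributing the carrier's energy through a steered binary
collision tree into warm packets that seed saturated thermal epidemics gives cost per corrupted forecast
`≍ E_pk/G(T) + O(log log M)/G(T) + O(M^{γ−1/4}) → 0` as `T = (M+1)^γ → ∞`, for EVERY `γ ∈ (0, 1/4)`; the statement is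
therefore believed FALSE (heuristic LD construction; see the module docstring). -/
def LightConeMeso : Prop :=
  ∀ (a θ : ℝ) (u₀ : V3), 0 < a → 0 < θ → ∃ σ₀ : ℝ, 0 < σ₀ ∧ ∀ σ : ℝ, 0 < σ → σ < σ₀ →
    ∃ γ₀ : ℝ, 0 < γ₀ ∧ ∀ γ : ℝ, 0 < γ → γ ≤ γ₀ → ∀ (lam δ : ℝ), 0 < lam → 0 < δ →
      ∃ M₀ : ℕ, ∀ M : ℕ, M₀ ≤ M → ∀ N : ℕ, M ≤ N → ∀ (Φ : Flow σ N) (Ψ : ClusterFlows σ N),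
        ∫⁻ z, ENNReal.ofReal (Real.exp (lam *
            (badCount Φ Ψ (horizon γ M * scale N) (horizon (1 / 4) M * scale N) z : ℝ)))
            ∂(gibbs σ a θ u₀ N Φ)
          ≤ ENNReal.ofReal (Real.exp (δ * (N + 1)))

/-- **Mesoscopic locality of the window pressure** (the card's `MesoLocality`, retyped one-directionally with
amplitude inflation in CONVEX form and with the quantifier order the composition needs — triage r1-2 (1),
r1-3 Doubt 2): for `σ < σ₀` there are `γ₀ > 0`, an inflation factor `C ≥ 1` and an amplitude `κ > 0` such that
for admissible `(φ, g)`, every `0 < γ ≤ γ₀` and `ε > 0`, for all reference sizes `M ≥ N₂(ε)` and every level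
`A ≥ 0`: IF the inflated observable `C·g` has `I_M(τ_M ℓ_M; φ, C g) ≤ e^{A(M+1)}` for every flow at size `M`
(`τ_M = (M+1)^γ`), THEN for all `N ≥ N₃` and every flow at size `N`, `I_N(τ_M ℓ_N; φ, g) ≤ e^{(A + ε)(N+1)}`.
In words `Λ_N(τ_M; g) ≤ Λ_M(τ_M; Cg) + ε`: the big system at the reference kinetic horizon is bounded by the
small system at its own mesoscopic window, at an inflated amplitude (chessboard Hölder yields the convex form
`C⁻¹Λ_M(Cg) + ε`, which implies this one since `Λ_M(Cg) ≥ 0` for centred `g` — `one_le_lintegral_exp_window`,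
proved by the disprover; the weaker form is registered because it is all the composition consumes). Decay-free
(constants: `κ ≤ Cκ + ε`; free gas: true), but it EXCLUDES an `N`-dependent relaxation time below the
light-cone scale — that is its content. It is the consequent of `stub_localityTransfer`, not a stub by itself. -/
def MesoLocality : Prop :=
  ∀ (a θ : ℝ) (u₀ : V3), 0 < a → 0 < θ → ∃ σ₀ : ℝ, 0 < σ₀ ∧ ∀ σ : ℝ, 0 < σ → σ < σ₀ →
    ∃ γ₀ : ℝ, 0 < γ₀ ∧ ∃ C : ℝ, 1 ≤ C ∧ ∃ κ : ℝ, 0 < κ ∧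
      ∀ (φ : T3 → ℝ) (g : V3 → ℝ), Continuous φ → Continuous g →
        (∀ x, |φ x| ≤ 1) → (∀ v, |g v| ≤ κ) → Orthogonal g →
        ∀ γ : ℝ, 0 < γ → γ ≤ γ₀ → ∀ ε : ℝ, 0 < ε → ∃ N₂ : ℕ, ∀ M : ℕ, N₂ ≤ M → ∀ A : ℝ, 0 ≤ A →
          (∀ Φ' : Flow σ M, ldLHS σ a θ u₀ φ (fun v => C * g v) (horizon γ M * scale M) M Φ'
              ≤ ENNReal.ofReal (Real.exp (A * (M + 1)))) →
          ∃ N₃ : ℕ, ∀ N : ℕ, N₃ ≤ N → ∀ Φ : Flow σ N,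
            ldLHS σ a θ u₀ φ g (horizon γ M * scale N) N Φ
              ≤ ENNReal.ofReal (Real.exp ((A + ε) * (N + 1)))

/-- Statement of `stub_localityTransfer` — **statics: the light cone makes the window pressure local**
(`LightConeMeso → MesoLocality`). Proof plan (size XL, thermodynamic formalism for window functionals, no
decay input): fix `M`, `τ = τ_M`, three scales in ℓ-units `R = M^{1/4} ≪ L' ≪ M^{1/3}` (cells of side `L'`,
corridors of width `2R`). UPPER bound at size `N`: replace trajectories by range-`R` forecasts,
`|F_window − F^loc| ≤ 2κ·#bad`, Hölder `(p, q)` puts `q⁻¹ log E_G e^{2κq·#bad} ≤ ε(N+1)` on the bill —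
`LightConeMeso` at `lam = 2κq` (size `N ≥ M`); chessboard Hölder `(1+η, (1+η)/η)` splits cell bulk from corridor
layer (layer pressure `≤` volume fraction `R/L'` × static LD of particle counts); bulk cells have disjoint
`R`-neighbourhoods, hence are conditionally independent given the corridors under the GRAND-canonical hard-core
law (finite-range DLR Markov property), and canonical `G_N` exponential moments are `≤` grand-canonical ones
`× P(number = N+1)⁻¹ = e^{O(log N)}`; `φ` is frozen per cell (`L'ℓ_N → 0`, uniform continuity). LOWER bound at
size `M`: reverse Hölder puts the inflation on the torus side, `Λ_M((1+η)·) ≥ (1+η)Λ_cells(·) − small`, cells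
filled by product/tiling tilts (DV variational principle), same light cone at size `M` for the cross terms,
equivalence of ensembles in the lower direction. Both directions compare to the same family of cell pressures
with boundary conditions confined to an `R`-layer, whence `Λ_N(g) ≤ C⁻¹Λ_M(Cg) + ε ≤ Λ_M(Cg) + ε`,
`C = (1+η)²·p` (last step: `Λ_M(Cg) ≥ 0`, tightness for centred `g`). Tools:
Ruelle1969 Ch. 3–4 (pressure independent of boundary conditions, low-density hard core), equivalence of
ensembles (KipnisLandim1999 App. 2), `Literature.Analysis.FluidPDE.localClusterState_congr` (R-locality of
forecasts), `canonicalDensity`/`particleLaw` API, `log_integral_exp_convexComb_le` (Hölder, tree). May need the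
light cone for conditional / sub-system laws: derive inside the proof by the same counting (helper lemmas). -/
def LocalityTransfer : Prop := LightConeMeso → MesoLocality


/-! ## Basic junk-free API of the frame (registered sub-goal `stub_mesoObjects`) -/

/-- The basic API of the frame, bundled: the microscopic length and the reference horizon are positive, and the
crux's one-body observable is measurable (continuity of `φ, g`) and bounded by `(N+1) κ`. (The same two facts for the
reducibly-equal frame of `…CorrectorPressureDecay.Negative.FastSectorSandwichFrame` are in tree; they are re-derived
inside the proof below, not restated as theorems.) -/
def MesoObjectsBasic : Prop :=
  (∀ N : ℕ, 0 < scale N) ∧ (∀ (γ : ℝ) (M : ℕ), 0 < horizon γ M) ∧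
  (∀ (θ : ℝ) (u₀ : V3) (φ : T3 → ℝ) (g : V3 → ℝ), Continuous φ → Continuous g →
    ∀ N : ℕ, Measurable (fluxObs θ u₀ φ g N)) ∧
  (∀ (θ κ : ℝ) (u₀ : V3) (φ : T3 → ℝ) (g : V3 → ℝ), (∀ x, |φ x| ≤ 1) → (∀ v, |g v| ≤ κ) →
    ∀ (N : ℕ) (z : Phase N), |fluxObs θ u₀ φ g N z| ≤ (N + 1) * κ)

/-- STUB `stub_mesoObjects` (registered sub-goal of the line; size S): the basic API `MesoObjectsBasic` holds. -/
theorem stub_mesoObjects : MesoObjectsBasic := by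
  refine ⟨fun N => Real.rpow_pos_of_pos (by positivity) _, fun γ M => Real.rpow_pos_of_pos (by positivity) _,
    fun θ u₀ φ g hφ hg N => ?_, fun θ κ u₀ φ g hφ1 hgκ N z => ?_⟩
  · refine Finset.measurable_sum _ fun i _ => ?_
    have h1 : Measurable fun z : Phase N => (z i).1 := (measurable_pi_apply i).fst
    have h2 : Measurable fun z : Phase N => (z i).2 := (measurable_pi_apply i).snd
    exact (hφ.measurable.comp h1).mul
      (hg.measurable.comp ((measurable_const_smul _).comp (h2.sub_const u₀)))
  · have hκ : 0 ≤ κ := (abs_nonneg _).trans (hgκ 0)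
    calc |fluxObs θ u₀ φ g N z|
        ≤ ∑ i, |φ (z i).1 * g ((Real.sqrt θ)⁻¹ • ((z i).2 - u₀))| := Finset.abs_sum_le_sum_abs _ _
      _ ≤ ∑ _i : Fin (N + 1), κ := by
          refine Finset.sum_le_sum fun i _ => ?_
          rw [abs_mul]
          calc |φ (z i).1| * |g ((Real.sqrt θ)⁻¹ • ((z i).2 - u₀))|
              ≤ 1 * κ := mul_le_mul (hφ1 _) (hgκ _) (abs_nonneg _) zero_le_one
            _ = κ := one_mul κ
      _ = (N + 1) * κ := by simp

end Summit.AtomisticToContinuum.HydrodynamicLimit.Theorems.MesoWindowSplit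

end
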